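import Literature.MathematicalPhysics.QuantumFieldTheory.Balaban1983to89.Node00.OpsYBondLift
import Literature.MathematicalPhysics.QuantumFieldTheory.Balaban1983to89.B9WalkLettersCoordsLeib

/-!
# `Balaban1983to89.B9WalkLettersBondLeib` — [B9] (3.100) p. 413 ∕ Sect. C p. 414: THE LEIBNIZ LETTERS OF THE BOND-SECTOR WALK (THEOREM 3.10) AS COORDINATE
# MODELS on the bond carrier `XBK κ i`, and the three Leibniz clauses `leibD ∕ leibT ∕ leibL` of the rows-19 schema `B9Thm310WholeDir.Identities310₂` AS THEOREMS
# (piece W-b, FILE 1 — the A-side twin of `B9WalkLettersCoordsLeib`; HOME `pub-ymgap-dag-n06-d/W-b-PLAN.md`, node00-def-Y `W-a-DESIGN.md` §1 last row)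

T. Bałaban, *Propagators for lattice gauge theories in a background field*, Commun. Math. Phys. **99** (1985) 389–434 [`Balaban1985BackgroundPropagators`, "B9"];
[4] = T. Bałaban, *Propagators and renormalization transformations for lattice gauge theories. II*, Commun. Math. Phys. **96** (1984) 223–250 [`Balaban1984PropagatorsII`].
statement-level skeleton of published theorems with citation tags; proofs where landed; nothing here is a claim about the Yang–Mills mass gap.

THE PRINT.  (3.100) p. 413: `∇_{U,μ}(hA) = h ∇_{U,μ}A + (∂⁺_μh)·R(U)A(· + e_μ)` on vector (bond) functions, its adjoint twin; p. 391 l. 9 «We have made here the identification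
A(x, x + ηe_μ) = A_μ(x)» (the vector sector is the `(d+1)`-fold copy of the scalar one); Sect. C p. 414 «the commutators … are first order differential operators with
coefficients determined by derivatives of the function h»; (3.105)–(3.107) pp. 414–416 (Theorem 3.10's expansion, whose algebraic structure the N06 certificate displays as
`B9Thm310WholeDir.Identities310₂ (𝔬A x) (𝔡A x) (𝔩A x) 1 (H x) U` inside its binder `h36A'`).  node00-def-Y's ✓`Node00.OpsYBondLift` («W-a, A side») proved the three Leibniz rules AS
OPERATOR IDENTITIES at the 𝔸-level bond letters in physical units: `liftBY_cdSL_mul_cutMulY` ∕ `cdBC_mul_cutMulY_leib` (`∇_{U,μ}∘M_h = M_h∘∇_{U,μ} + M_{∂⁺_μh}∘(c_f·lift S_μ)`, (3.100) forward),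
`cutMulY_mul_cdsBC_leib` (`M_h∘∇*_{U,μ} = ∇*_{U,μ}∘M_h + C^{Lt,B}_μ`, letter `cltBY`), `lapBC_mul_cutMulY` (`Δ_U∘M_h = M_h∘Δ_U − (Σ_μ P^B_μ∘∇_{U,μ} + c_f²·M_{Δh})`, letter `pKBY`).

THE POINT (the N06 certificate, dag-n06-d; rows 19).  The certificate reads its bond-sector operators on the coordinate carrier `XBK κ i = FBondY i × Fin (d+1) × κ × κ` through
`B9CoReadingCoords.coordOpK b`, with the pins `D U = DcoK = coordOpK b (ν ↦ cdBₗ U ν)`, `Dstar U = DscoK`, `Lap U = LcoK`, `𝔡.Dd U μ = coordOpK b (fun _ => cdBₗ U μ)`.  THIS FILE defines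
the matching coordinate models of def-Y's bond Leibniz letters and proves the three U-ALGEBRAIC Leibniz clauses of `Identities310₂` at them:
* §1 (private) restriction-of-scalars bookkeeping; ★ `coordAlgHomB` (the constant-family coordinate model `T ↦ coordOpK b (fun _ => T|_ℝ)` IS an ℝ-algebra morphism
  `Module.End ℂ (FBondY i → 𝔸) →ₐ[ℝ] Module.End ℝ (XBK κ i → ℝ)`, twin of `B9WalkLettersCoordsLeib.coordAlgHom`); `mulOp_bond_eq_coordOpK` (a real site multiplier read at `b₋` on
  the carrier IS the model of `cutMulY (hBdY h)` — the rows-19 record's `mulOp (𝔬.h □)`);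
* §2 the models `mulcoB` (`M_h`), `dirDcoB ∕ dirDscoB` (`∇_{U,μ}`, `∇*_{U,μ}` — LITERALLY the certificate's `h𝔡Ad ∕ h𝔡As` shapes), `cdcoB` (`C^D`), `cltcoB` (`C^{Lt}`), `plcoB`
  (`P^L_μ := −P^B_μ`), `clcoB` (`C^L := −c_f²·M_{Δh}`);
* §3 ★★ `leibD_coordsB` (`DcoK ∘ M_h = M_h ∘ DcoK + (0 ∘ DcoK + C^D)` — `Identities310₂.leibD` with `PD := 0`), ★★ `leibT_coordsB` (`M_h ∘ DscoK = DscoK ∘ M_h + C^{Lt}`),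
  ★★ `leibL_coordsB` (`LcoK ∘ M_h = M_h ∘ LcoK + (Σ_μ P^L_μ * Dd_μ + C^L)`) — in the LITERAL shapes of `Identities310₂.leibD ∕ leibT ∕ leibL` at `D := DcoK`, `Dstar := DscoK`,
  `Lap := LcoK`, `Dd := dirDcoB`.
The kernel dominations `hPD hCD hPL hCL hCLt` (U-free kernels = this lane's SITE kernels ✓`B9WalkLettersKernels`, transferred along def-Y's direction-blind bond map), the record
`ops310WalkYO` and `StaticOK310` are W-b FILES 2–4 (HOME `W-b-PLAN.md`); the four laws `inv ∕ invT ∕ eq3105 ∕ eq3105T` stay DISPLAYED at the record (design-open letters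
`Δa ∕ Rf ∕ Rt`, (Q1) = P0 discipline).
HONEST SCOPE.  Definitions with bodies + operator algebra over landed identities ([folklore]); nothing of [B9]'s estimates asserted; COUNT-NEUTRAL; N06 NOT discharged; one
finite 𝕋⁴ programme at fixed `ε` — NOT continuum, NOT OS, NOT the mass gap ∕ Clay.  Cell `pub-ymgap` (HUMAN RULING D-0062), node N06 [B9], seat `pub-ymgap-dag-n06-d` (g31),
2026-08-31.  NEW file.
-/

noncomputable section

namespace Literature.MathematicalPhysics.QuantumFieldTheory.Balaban1983to89.B9WalkLettersBondLeib

open Node00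
open Node00.OpsYLeibnizLetters (fdiffY lapDiffY fshiftSL pKY cltY)
open Node00.OpsYBondLift (liftBY liftBY_apply cdBC cdsBC lapBC pKBY cltBY cdBₗ_eq_restrict cdsBₗ_eq_restrict lapBₗ_eq_restrict liftBY_cdSL_mul_cutMulY
  cutMulY_mul_cdsBC_leib lapBC_mul_cutMulY)
open Node00.OpsYNablaBridge (chartY)
open Node00.OpsYSectDCoords (coordOpK_add coordOpK_sub coordOpK_smul coordOpK_const_mul coordOpK_const_one repr_assembleK)
open B6KLevelCensusIndexV1 (KIdx)
open B9Eq3104CutoffCommutators (hBdY hBdY_apply)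
open B9Thm37CubeCoverCommutators (cutMulY cutMulY_apply)
open B9Thm37Sum (mulOp)
open B9CoReadingCoords (XBK coordOpK coordOpK_apply coordOpK_comp DcoK DscoK LcoK cdBₗ cdsBₗ lapBₗ)
open B9WalkLettersCoordsLeib (coordOpK_sum coordOpK_zero coordOpK_neg)

variable {𝔸 : Type} [NormedRing 𝔸] [NormedAlgebra ℂ 𝔸] [CompleteSpace 𝔸]
variable {κ : Type} [Fintype κ] [DecidableEq κ]
variable {d ℓ : ℕ} {hd : 1 ≤ d + 1} {hL : Odd (ℓ + 1) ∧ 1 < ℓ + 1} {b₀ b₁ : ℝ}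
variable (i : KIdx d ℓ hd hL b₀ b₁) (b : Module.Basis κ ℝ 𝔸) (B : B9.Backgrounds) (cfg : B.Cfg → CfgY 𝔸 i)

/-! ## §1 Bookkeeping: restriction of scalars; the constant-family model as an ℝ-algebra morphism; the cut-off dictionary -/

section RS

variable {V : Type} [AddCommGroup V] [Module ℂ V]

omit [Fintype κ] [DecidableEq κ] in
/-- `(A * C)|_ℝ = A|_ℝ ∘ C|_ℝ`. [folklore] -/
private theorem rS_mul (A C : Module.End ℂ V) : (A * C).restrictScalars ℝ = A.restrictScalars ℝ ∘ₗ C.restrictScalars ℝ := rfl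

omit [Fintype κ] [DecidableEq κ] in
/-- `(A + C)|_ℝ = A|_ℝ + C|_ℝ`. [folklore] -/
private theorem rS_add (A C : Module.End ℂ V) : (A + C).restrictScalars ℝ = A.restrictScalars ℝ + C.restrictScalars ℝ := rfl

omit [Fintype κ] [DecidableEq κ] in
/-- `(A − C)|_ℝ = A|_ℝ − C|_ℝ`. [folklore] -/
private theorem rS_sub (A C : Module.End ℂ V) : (A - C).restrictScalars ℝ = A.restrictScalars ℝ - C.restrictScalars ℝ := rfl

omit [Fintype κ] [DecidableEq κ] in
/-- `1|_ℝ = 1`. [folklore] -/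
private theorem rS_one : (1 : Module.End ℂ V).restrictScalars ℝ = (1 : Module.End ℝ V) := rfl

omit [Fintype κ] [DecidableEq κ] in
/-- `0|_ℝ = 0`. [folklore] -/
private theorem rS_zero : (0 : Module.End ℂ V).restrictScalars ℝ = (0 : Module.End ℝ V) := rfl

omit [Fintype κ] [DecidableEq κ] in
/-- `(Σ_μ A_μ)|_ℝ = Σ_μ A_μ|_ℝ`. [folklore] -/
private theorem rS_sum {P : Type} [Fintype P] (A : P → Module.End ℂ V) : (∑ μ, A μ).restrictScalars ℝ = ∑ μ, (A μ).restrictScalars ℝ :=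
  LinearMap.ext fun v => by rw [LinearMap.restrictScalars_apply, LinearMap.sum_apply, LinearMap.sum_apply]; rfl

omit [Fintype κ] [DecidableEq κ] in
/-- a REAL scalar passes through the restriction of scalars: `((r : ℂ) • A)|_ℝ = r • A|_ℝ`. [folklore] -/
private theorem rS_smul_real (r : ℝ) (A : Module.End ℂ V) : ((r : ℂ) • A).restrictScalars ℝ = r • A.restrictScalars ℝ :=
  LinearMap.ext fun v => by
    rw [LinearMap.restrictScalars_apply, LinearMap.smul_apply, LinearMap.smul_apply, LinearMap.restrictScalars_apply, Complex.coe_smul]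

end RS

/-- ★ **THE CONSTANT-FAMILY COORDINATE MODEL ON THE BOND CARRIER IS AN ℝ-ALGEBRA MORPHISM** `Module.End ℂ (FBondY i → 𝔸) →ₐ[ℝ] Module.End ℝ (XBK κ i → ℝ)`
(functoriality of `coordOpK` on `XBK`: products, sums, units, real scalars) — the A-side twin of `B9WalkLettersCoordsLeib.coordAlgHom`.
[cite: Balaban1985BackgroundPropagators, (3.42) p.397, dictionary] -/
def coordAlgHomB : Module.End ℂ (FBondY i → 𝔸) →ₐ[ℝ] Module.End ℝ (XBK κ i → ℝ) where
  toFun A := coordOpK b (fun _ : Fin (d + 1) => A.restrictScalars ℝ)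
  map_one' := by simp only [rS_one, coordOpK_const_one]
  map_mul' A C := by simp only [rS_mul, ← Module.End.mul_eq_comp, coordOpK_const_mul]
  map_zero' := by simp only [rS_zero, coordOpK_zero]
  map_add' A C := by simp only [rS_add, coordOpK_add]
  commutes' r := by
    rw [Algebra.algebraMap_eq_smul_one, Algebra.algebraMap_eq_smul_one]
    have h : ((r • (1 : Module.End ℂ (FBondY i → 𝔸))).restrictScalars ℝ) = r • (1 : Module.End ℝ (FBondY i → 𝔸)) := rfl
    simp only [h, coordOpK_smul, coordOpK_const_one]

omit [DecidableEq κ] [CompleteSpace 𝔸] in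
/-- `coordAlgHomB`, unfolded. [cite: Balaban1985BackgroundPropagators, (3.42) p.397, dictionary] -/
theorem coordAlgHomB_apply (A : Module.End ℂ (FBondY i → 𝔸)) : coordAlgHomB i b A = coordOpK b (fun _ : Fin (d + 1) => A.restrictScalars ℝ) := rfl

omit [DecidableEq κ] [CompleteSpace 𝔸] in
/-- ★ **THE CUT-OFF DICTIONARY ON THE BOND CARRIER**: a real site function `w`, read on bonds at the initial point `b₋` ((3.100)'s `h(x)` for `b = ⟨x, x + ηe_μ⟩`) and acting by
multiplication on the coordinate carrier, IS the coordinate model of `cutMulY (hBdY i w)` (a real scalar commutes with the coordinates) — the rows-19 record's `mulOp (𝔬.h □)`;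
A-side twin of `B9Eq346OneSidedLegsModelsL2.mulOp_site_eq_coordOpK`. [cite: Balaban1985BackgroundPropagators, (3.87) p.409 («h_□»), (3.100) p.413, p.397 (coordinates), dictionary] -/
theorem mulOp_bond_eq_coordOpK (w : SiteY i → ℝ) :
    mulOp (fun p : XBK κ i => w (chartY i p.1.src)) = coordOpK b (fun _ : Fin (d + 1) => (cutMulY (𝔸 := 𝔸) (hBdY i w)).restrictScalars ℝ) := by
  apply LinearMap.ext; intro f; funext p
  rw [coordOpK_apply, LinearMap.restrictScalars_apply, cutMulY_apply, hBdY_apply, Complex.coe_smul, map_smul, Finsupp.smul_apply, smul_eq_mul, repr_assembleK]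
  rfl

/-! ## §2 The coordinate models of the bond Leibniz letters -/

/-- `M_h` on the bond carrier: the constant family of the real cut-off `cutMulY (hBdY i h)` (the certificate's `mulOp (𝔬A.h □)` at `h := h_□`, by `mulOp_bond_eq_coordOpK`).
[cite: Balaban1985BackgroundPropagators, (3.87) p.409 («h_□»), (3.100) p.413] -/
def mulcoB (h : SiteY i → ℝ) : Module.End ℝ (XBK κ i → ℝ) := coordOpK b (fun _ : Fin (d + 1) => (cutMulY (𝔸 := 𝔸) (hBdY i h)).restrictScalars ℝ)

/-- `∇_{U,μ}` on every slice of the bond carrier — LITERALLY the certificate's pin shape `h𝔡Ad : (𝔡A x).Dd U = fun μ => coordOpK b (fun _ => cdBₗ U μ)` (physical units are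
inside def-Y's `cdBₗ = (c_f·lift ∇_{U,μ})|_ℝ`). [cite: Balaban1985BackgroundPropagators, (3.3) p.390, (3.42) p.397] -/
def dirDcoB (U₁ : B.Cfg) (μ : Fin (d + 1)) : Module.End ℝ (XBK κ i → ℝ) := coordOpK b (fun _ : Fin (d + 1) => cdBₗ i (cfg U₁) μ)

/-- `∇*_{U,μ}` on every slice of the bond carrier — the certificate's pin shape `h𝔡As`. [cite: Balaban1985BackgroundPropagators, (3.8) p.392, (3.42) p.397] -/
def dirDscoB (U₁ : B.Cfg) (μ : Fin (d + 1)) : Module.End ℝ (XBK κ i → ℝ) := coordOpK b (fun _ : Fin (d + 1) => cdsBₗ i (cfg U₁) μ)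

/-- the `leibD` letter `C^D(U,h)` of the vector sector: on slice `ν`, `c_f·M_{∂⁺_νh} ∘ lift S_ν` read at `b₋` — (3.100) forward in the SHIFT form of def-Y's
`liftBY_cdSL_mul_cutMulY` (the shape of the site twin `B9WalkLettersCoordsLeib.cdcoS = η⁻¹·M_{∂⁺_νh}∘S_ν`, so that the site kernel `kCDY` transfers).
[cite: Balaban1985BackgroundPropagators, (3.100) p.413] -/
def cdcoB (U₁ : B.Cfg) (h : SiteY i → ℝ) : Module.End ℝ (XBK κ i → ℝ) :=
  coordOpK b (fun ν : Fin (d + 1) =>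
    (((i.cf : ℝ) : ℂ) • (cutMulY (hBdY i (fdiffY i h ν)) * liftBY i (fshiftSL i (cfg U₁) ν))).restrictScalars ℝ)

/-- the `leibT` letter `C^{Lt}(U,h)` of the vector sector: on slice `ν`, def-Y's `cltBY U h ν = c_f·lift C^{Lt}_ν` ((3.100) backward). [cite: Balaban1985BackgroundPropagators, (3.100) p.413, (3.8) p.392] -/
def cltcoB (U₁ : B.Cfg) (h : SiteY i → ℝ) : Module.End ℝ (XBK κ i → ℝ) := coordOpK b (fun ν : Fin (d + 1) => (cltBY i (cfg U₁) h ν).restrictScalars ℝ)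

/-- the `leibL` letter `P^L_μ(U,h) := −P^B_μ(U,h)` (def-Y's `pKBY`, physical units; to be composed with `Dd_μ = dirDcoB μ`).
[cite: Balaban1985BackgroundPropagators, (3.88)–(3.89) p.409, (3.100) p.413, Sect. C p.414] -/
def plcoB (U₁ : B.Cfg) (h : SiteY i → ℝ) (μ : Fin (d + 1)) : Module.End ℝ (XBK κ i → ℝ) :=
  coordOpK b (fun _ : Fin (d + 1) => (-pKBY i (cfg U₁) h μ).restrictScalars ℝ)

/-- the `leibL` letter `C^L(h) := −c_f²·M_{Δh}` of the vector sector. [cite: Balaban1985BackgroundPropagators, (3.88) p.409, (3.100) p.413, Sect. C p.414] -/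
def clcoB (h : SiteY i → ℝ) : Module.End ℝ (XBK κ i → ℝ) :=
  coordOpK b (fun _ : Fin (d + 1) => (-(((i.cf ^ 2 : ℝ) : ℂ) • cutMulY (𝔸 := 𝔸) (hBdY i (lapDiffY i h)))).restrictScalars ℝ)

/-! ## §3 The three Leibniz clauses of `Identities310₂` at the models -/

omit [DecidableEq κ] in
/-- the pinned `D U = DcoK` IS the slice family of def-Y's bundled `ℂ`-linear `∇_{U,ν}` restricted to `ℝ`. [cite: Balaban1985BackgroundPropagators, (3.3) p.390, (3.42) p.397, bookkeeping] -/
theorem DcoK_eq (U₁ : B.Cfg) : DcoK i b B cfg U₁ = coordOpK b (fun ν : Fin (d + 1) => (cdBC i (cfg U₁) ν).restrictScalars ℝ) := by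
  have h : (fun ν : Fin (d + 1) => cdBₗ i (cfg U₁) ν) = fun ν => (cdBC (𝔸 := 𝔸) i (cfg U₁) ν).restrictScalars ℝ := funext fun ν => cdBₗ_eq_restrict i (cfg U₁) ν
  rw [DcoK, h]

omit [DecidableEq κ] in
/-- the pinned `Dstar U = DscoK` IS the slice family of `∇*_{U,ν}` restricted to `ℝ`. [cite: Balaban1985BackgroundPropagators, (3.8) p.392, (3.42) p.397, bookkeeping] -/
theorem DscoK_eq (U₁ : B.Cfg) : DscoK i b B cfg U₁ = coordOpK b (fun ν : Fin (d + 1) => (cdsBC i (cfg U₁) ν).restrictScalars ℝ) := by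
  have h : (fun ν : Fin (d + 1) => cdsBₗ i (cfg U₁) ν) = fun ν => (cdsBC (𝔸 := 𝔸) i (cfg U₁) ν).restrictScalars ℝ := funext fun ν => cdsBₗ_eq_restrict i (cfg U₁) ν
  rw [DscoK, h]

omit [DecidableEq κ] in
/-- the pinned `Lap U = LcoK` IS the constant family of the bundled covariant Laplacian `Δ_U` of the vector sector restricted to `ℝ`.
[cite: Balaban1985BackgroundPropagators, (3.23) p.394, (3.42) p.397, bookkeeping] -/
theorem LcoK_eq (U₁ : B.Cfg) : LcoK i b B cfg U₁ = coordOpK b (fun _ : Fin (d + 1) => (lapBC i (cfg U₁)).restrictScalars ℝ) := by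
  have h : (fun _ : Fin (d + 1) => lapBₗ i (cfg U₁)) = fun _ : Fin (d + 1) => (lapBC (𝔸 := 𝔸) i (cfg U₁)).restrictScalars ℝ := funext fun _ => lapBₗ_eq_restrict i (cfg U₁)
  rw [LcoK, h]

omit [DecidableEq κ] in
/-- the pinned direction letter `Dd U μ = dirDcoB μ` IS the constant family of `∇_{U,μ}` restricted to `ℝ`. [cite: Balaban1985BackgroundPropagators, (3.3) p.390, bookkeeping] -/
theorem dirDcoB_eq (U₁ : B.Cfg) (μ : Fin (d + 1)) : dirDcoB i b B cfg U₁ μ = coordOpK b (fun _ : Fin (d + 1) => (cdBC i (cfg U₁) μ).restrictScalars ℝ) := by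
  have h : (fun _ : Fin (d + 1) => cdBₗ i (cfg U₁) μ) = fun _ : Fin (d + 1) => (cdBC (𝔸 := 𝔸) i (cfg U₁) μ).restrictScalars ℝ := funext fun _ => cdBₗ_eq_restrict i (cfg U₁) μ
  rw [dirDcoB, h]

omit [DecidableEq κ] in
/-- the pinned direction letter `Dsd U μ = dirDscoB μ` IS the constant family of `∇*_{U,μ}` restricted to `ℝ`. [cite: Balaban1985BackgroundPropagators, (3.8) p.392, bookkeeping] -/
theorem dirDscoB_eq (U₁ : B.Cfg) (μ : Fin (d + 1)) : dirDscoB i b B cfg U₁ μ = coordOpK b (fun _ : Fin (d + 1) => (cdsBC i (cfg U₁) μ).restrictScalars ℝ) := by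
  have h : (fun _ : Fin (d + 1) => cdsBₗ i (cfg U₁) μ) = fun _ : Fin (d + 1) => (cdsBC (𝔸 := 𝔸) i (cfg U₁) μ).restrictScalars ℝ := funext fun _ => cdsBₗ_eq_restrict i (cfg U₁) μ
  rw [dirDscoB, h]

omit [Fintype κ] [DecidableEq κ] in
/-- **(3.100) forward on the vector sector, physical units, SHIFT form**: `∇^B_{U,μ} ∘ M_h = M_h ∘ ∇^B_{U,μ} + c_f·(M_{∂⁺_μh} ∘ lift S_μ)` — def-Y's lattice-units
`liftBY_cdSL_mul_cutMulY` scaled by `c_f` (the companion of def-Y's `cdBC_mul_cutMulY_leib`, whose letter is `M_{∂⁺_μh}∘∇_{U,μ} + c_f·M_{∂⁺_μh}`).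
[cite: Balaban1985BackgroundPropagators, (3.100) p.413, p.391] -/
theorem cdBC_mul_cutMulY_shift (U : CfgY 𝔸 i) (μ : Fin (d + 1)) (h : SiteY i → ℝ) :
    cdBC i U μ * cutMulY (hBdY i h) = cutMulY (hBdY i h) * cdBC i U μ + ((i.cf : ℝ) : ℂ) • (cutMulY (hBdY i (fdiffY i h μ)) * liftBY i (fshiftSL i U μ)) := by
  rw [Node00.OpsYBondLift.cdBC, smul_mul_assoc, liftBY_cdSL_mul_cutMulY, smul_add, mul_smul_comm]

omit [DecidableEq κ] in
/-- ★★ **`Identities310₂.leibD` AT THE MODELS** ((3.100) forward on the vector sector through the coordinates): `∇_U∘M_h = M_h∘∇_U + (0∘∇_U + C^D(U,h))` on the bond carrier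
(`PD := 0`; `D := DcoK`, `M_h := mulcoB h`, `C^D := cdcoB U h`; `hY = h` since `X = Y = XBK`). [cite: Balaban1985BackgroundPropagators, (3.100) p.413, (3.42) p.397] -/
theorem leibD_coordsB (U₁ : B.Cfg) (h : SiteY i → ℝ) :
    DcoK i b B cfg U₁ ∘ₗ mulcoB i b h = mulcoB i b h ∘ₗ DcoK i b B cfg U₁ + ((0 : Module.End ℝ (XBK κ i → ℝ)) ∘ₗ DcoK i b B cfg U₁ + cdcoB i b B cfg U₁ h) := by
  have hν : (fun ν : Fin (d + 1) => (cdBC i (cfg U₁) ν).restrictScalars ℝ ∘ₗ (cutMulY (𝔸 := 𝔸) (hBdY i h)).restrictScalars ℝ) =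
      fun ν => (cutMulY (𝔸 := 𝔸) (hBdY i h)).restrictScalars ℝ ∘ₗ (cdBC i (cfg U₁) ν).restrictScalars ℝ
        + (((i.cf : ℝ) : ℂ) • (cutMulY (hBdY i (fdiffY i h ν)) * liftBY i (fshiftSL i (cfg U₁) ν))).restrictScalars ℝ := by
    funext ν; rw [← rS_mul, cdBC_mul_cutMulY_shift, rS_add, rS_mul]
  rw [DcoK_eq, mulcoB, cdcoB, LinearMap.zero_comp, zero_add, coordOpK_comp, coordOpK_comp, hν, coordOpK_add]

omit [DecidableEq κ] in
/-- ★★ **`Identities310₂.leibT` AT THE MODELS** ((3.100) backward): `M_h∘∇*_U = ∇*_U∘M_h + C^{Lt}(U,h)` on the bond carrier (`Dstar := DscoK`, `C^{Lt} := cltcoB U h`).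
[cite: Balaban1985BackgroundPropagators, (3.100) p.413, (3.8) p.392] -/
theorem leibT_coordsB (U₁ : B.Cfg) (h : SiteY i → ℝ) :
    mulcoB i b h ∘ₗ DscoK i b B cfg U₁ = DscoK i b B cfg U₁ ∘ₗ mulcoB i b h + cltcoB i b B cfg U₁ h := by
  have hν : (fun ν : Fin (d + 1) => (cutMulY (𝔸 := 𝔸) (hBdY i h)).restrictScalars ℝ ∘ₗ (cdsBC i (cfg U₁) ν).restrictScalars ℝ) =
      fun ν => (cdsBC i (cfg U₁) ν).restrictScalars ℝ ∘ₗ (cutMulY (𝔸 := 𝔸) (hBdY i h)).restrictScalars ℝ + (cltBY i (cfg U₁) h ν).restrictScalars ℝ := by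
    funext ν; rw [← rS_mul, cutMulY_mul_cdsBC_leib, rS_add, rS_mul]
  rw [DscoK_eq, mulcoB, cltcoB, coordOpK_comp, coordOpK_comp, hν, coordOpK_add]

omit [DecidableEq κ] in
/-- ★★ **`Identities310₂.leibL` AT THE MODELS** (the Laplacian Leibniz rule of the vector sector with the first-order letters in the direction-family form):
`Δ_U∘M_h = M_h∘Δ_U + (Σ_μ P^L_μ * ∇_{U,μ} + C^L)` on the bond carrier, `Δ_U = LcoK`, `∇_{U,μ} = dirDcoB μ`, `P^L_μ = −P^B_μ`, `C^L = −c_f²·M_{Δh}` (def-Y's `lapBC_mul_cutMulY`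
through the algebra morphism `coordAlgHomB`). [cite: Balaban1985BackgroundPropagators, (3.88)–(3.89) p.409, (3.100) p.413, Sect. C p.414] -/
theorem leibL_coordsB (U₁ : B.Cfg) (h : SiteY i → ℝ) :
    LcoK i b B cfg U₁ ∘ₗ mulcoB i b h =
      mulcoB i b h ∘ₗ LcoK i b B cfg U₁ + ((∑ μ, plcoB i b B cfg U₁ h μ * dirDcoB i b B cfg U₁ μ) + clcoB i b h) := by
  -- the 𝔸-level identity in the `+`-shape of `Identities310₂.leibL` (negations inside the letters)
  have hA : lapBC i (cfg U₁) * cutMulY (hBdY i h) = cutMulY (hBdY i h) * lapBC i (cfg U₁)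
      + ((∑ μ : Fin (d + 1), (-pKBY i (cfg U₁) h μ) * cdBC i (cfg U₁) μ) + -(((i.cf ^ 2 : ℝ) : ℂ) • cutMulY (𝔸 := 𝔸) (hBdY i (lapDiffY i h)))) := by
    rw [lapBC_mul_cutMulY, sub_eq_add_neg, neg_add, ← Finset.sum_neg_distrib]
    congr 2
  -- everything is `φ(letter)` for the algebra morphism `φ := coordAlgHomB`
  have eL : LcoK i b B cfg U₁ = coordAlgHomB i b (lapBC i (cfg U₁)) := LcoK_eq i b B cfg U₁
  have eM : mulcoB i b h = coordAlgHomB i b (cutMulY (hBdY i h)) := rfl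
  have eD : ∀ μ, dirDcoB i b B cfg U₁ μ = coordAlgHomB i b (cdBC i (cfg U₁) μ) := fun μ => dirDcoB_eq i b B cfg U₁ μ
  have eP : ∀ μ, plcoB i b B cfg U₁ h μ = coordAlgHomB i b (-pKBY i (cfg U₁) h μ) := fun μ => rfl
  have eC : clcoB i b h = coordAlgHomB i b (-(((i.cf ^ 2 : ℝ) : ℂ) • cutMulY (𝔸 := 𝔸) (hBdY i (lapDiffY i h)))) := rfl
  rw [eL, eM, eC, ← Module.End.mul_eq_comp, ← Module.End.mul_eq_comp, ← map_mul, ← map_mul, hA, map_add, map_add, map_sum]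
  simp only [map_mul, eP, eD]

end Literature.MathematicalPhysics.QuantumFieldTheory.Balaban1983to89.B9WalkLettersBondLeib

end
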